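import Summits.BirchSwinnertonDyer.Rank1Residual.F1Sign2.TwoAdicBSDRankOneSsAtTwo
import Summits.BirchSwinnertonDyer.BirchSwinnertonDyer.Theorems.ByReductionTypeAtTwoRankOnePerrinRiouShaOrderAtTwo
import HarnessLib

/-!
# The two formal-logarithm symbols of the supersingular-at-2 typings agree: `prLog W ι P = logOmegaAt W 2 P` and
# `padicLogOrd W 2 ι P = v₂(logOmegaAt W 2 P)` (log-decl compatibility for the ♯/♭ ↔ η dictionary; all PROVED)

Cell `bsd-f1-sign2`, seat `-an` g52 (MEMO-an §56.10), crux `stmt-BirchSwinnertonDyer-23715`; helper file, closes nothing.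

The `-an` family (55A/55B/56A, `Theorems/ByReductionTypeAtTwoRankOnePerrinRiouElementAtTwo`) reads a rational point `P` as a point of
`W.baseChange ℚ` through an embedding `ι : ℚ →+* ℚ₂` (`padicPointOf`, `prLog`, `padicLogOrd` — the anticyclotomic cell's symbols);
the `-es` family (K2-Vss/K2-Tss/K2-Kss, `Rank1Residual/F1Sign2/TwoAdicBSDRankOneSsAtTwo`) reads `P ∈ W(ℚ)` directly (`pointToPadic`,
`logOmegaAt = Kato2004.padicLogLocal ∘ pointToPadic`).  This file proves that the two readings coincide, removing item (i) of the
"NOT PROVED" list of `Theorems/ByReductionTypeAtTwoRankOneSprungEtaBridgeAtTwo` (the B56 bridge file):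
* `prLog_eq_padicLogLocal` — `prLog W ι P = padicLogLocal W 2 (padicPointOf W 2 ι P)` (`rfl`: same body `log_W(z(m₀•Q))/m₀`);
* `logOmegaAt_eq_padicLogLocal` — `rfl`;
* `padicPointOf_eq_pointToPadic` — `padicPointOf W 2 ι P = pointToPadic W 2 P` for `P ∈ W(ℚ)` (`ℚ →ₐ[ℚ] ℚ₂` is a subsingleton; the point
  types of `W` and `W.baseChange ℚ` agree definitionally; the two `DecidableEq ℚ` instances are reconciled by `congr!`);
* `prLog_eq_logOmegaAt` — `prLog W ι P = logOmegaAt W 2 P`;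
* `padicLogOrd_eq_valuation_logOmegaAt` — for `logOmegaAt W 2 P ≠ 0`, `padicLogOrd W 2 ι P = (logOmegaAt W 2 P).valuation` (via g51
  `valuation_prLog_eq`).
What remains for `56A ↔ K2-Vss` modulo B56 (next generation): the index lemma `[E(ℚ) : ℤ·P₀] = #E(ℚ)_tors` for a rank-one Mordell–Weil basis,
`plusPeriod f ≠ 0`, and the non-vanishing `PR ≠ 0` / `log_ω(P₀) ≠ 0` on the slice.  BSD is not proved by any of this; 23715 is not closed.
References: [cite: SilvermanAEC2009, IV.6.4, VII.2.2] [cite: Castella2018, §2.2].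
-/

noncomputable section

open WeierstrassCurve Literature.NumberTheory.EllipticCurves Summit.BirchSwinnertonDyer.Rank1Residual.F1Sign2

namespace Summit.BirchSwinnertonDyer.BirchSwinnertonDyer.Theorems.PerrinRiouElementAtTwo

set_option linter.dupNamespace false

/-- `prLog = padicLogLocal ∘ padicPointOf` (same body). [folklore] -/
theorem prLog_eq_padicLogLocal (W : WeierstrassCurve ℚ) [W.IsElliptic] [W.IsGloballyMinimal] (ι : ℚ →+* ℚ_[2])
    (P : (W.baseChange ℚ).toAffine.Point) :
    prLog W ι P = Kato2004.padicLogLocal W 2 (padicPointOf W 2 ι P) := rfl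

/-- `logOmegaAt = padicLogLocal ∘ pointToPadic` (its definition). [folklore] -/
theorem logOmegaAt_eq_padicLogLocal (W : WeierstrassCurve ℚ) [W.IsElliptic] [W.IsGloballyMinimal] (P : W.toAffine.Point) :
    logOmegaAt W 2 P = Kato2004.padicLogLocal W 2 (pointToPadic W 2 P) := rfl

/-- The point transport: reading `P₀ ∈ W(ℚ)` in `W(ℚ₂)` directly (`pointToPadic`, η family) or as a point of `W.baseChange ℚ`
through any `ι : ℚ →+* ℚ₂` (`padicPointOf`, ♯/♭ family) agrees (`ℚ →ₐ[ℚ] ℚ₂` is a subsingleton; `(W.baseChange ℚ).toAffine.Point` and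
`W.toAffine.Point` agree definitionally). [folklore] -/
theorem padicPointOf_eq_pointToPadic (W : WeierstrassCurve ℚ) (ι : ℚ →+* ℚ_[2]) (P : W.toAffine.Point) :
    padicPointOf W 2 ι (K := ℚ) P = pointToPadic W 2 P := by
  have hι : ι.toRatAlgHom = Algebra.ofId ℚ ℚ_[2] := Subsingleton.elim _ _
  unfold padicPointOf pointToPadic
  congr!

/-- Hence the two formal logarithms of the two families coincide on rational points: `prLog W ι P = logOmegaAt W 2 P`. [folklore] -/
theorem prLog_eq_logOmegaAt (W : WeierstrassCurve ℚ) [W.IsElliptic] [W.IsGloballyMinimal] (ι : ℚ →+* ℚ_[2])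
    (P : W.toAffine.Point) : prLog W ι P = logOmegaAt W 2 P := by
  rw [prLog_eq_padicLogLocal, logOmegaAt_eq_padicLogLocal, padicPointOf_eq_pointToPadic]

/-- And the `-an` valuation symbol is the valuation of the `-es` logarithm: `padicLogOrd W 2 ι P = v₂(logOmegaAt W 2 P)` whenever
`logOmegaAt W 2 P ≠ 0` (g51 `valuation_prLog_eq`). [folklore] -/
theorem padicLogOrd_eq_valuation_logOmegaAt (W : WeierstrassCurve ℚ) [W.IsElliptic] [W.IsGloballyMinimal] (ι : ℚ →+* ℚ_[2])
    (P : W.toAffine.Point) (hP : logOmegaAt W 2 P ≠ 0) :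
    padicLogOrd W 2 ι (K := ℚ) P = (logOmegaAt W 2 P).valuation := by
  have h := valuation_prLog_eq W ι P (by rwa [prLog_eq_logOmegaAt])
  rw [prLog_eq_logOmegaAt] at h
  exact h.symm

end Summit.BirchSwinnertonDyer.BirchSwinnertonDyer.Theorems.PerrinRiouElementAtTwo
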